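import Summits.AtomisticToContinuum.FouriersLaw.Theorems.BondHeatUncertaintyExtensiveSnapshotIrreversibilityEnergyWindowKernelLossLadderA

/-!
# «EnergyWindowKernelLossLadder» (lens-1 g75 node L: loss profiles, the loss-graded family S3[ϕ], S3♭/S3♮/S3∂, the energy shell, junctions) — part 2 of 2 (sequel of `…BondHeatUncertaintyExtensiveSnapshotIrreversibilityEnergyWindowKernelLossLadderA`)

Split for the 400-line cap by the landing lane (hand-2 g30); the module docstring of part 1 (`…BondHeatUncertaintyExtensiveSnapshotIrreversibilityEnergyWindowKernelLossLadderA`) describes the whole node.  Same namespace; all FQNs unchanged.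
0 sorry; standard axioms.
-/

noncomputable section

namespace Summit.AtomisticToContinuum.FouriersLaw.Theorems.ExtensiveSnapshotIrreversibility.EnergyWindow

open MeasureTheory ProbabilityTheory Filter Topology Real
open scoped ENNReal NNReal
open Literature.MathematicalPhysics.KineticTheory.HeatConduction
open Literature.Probability.Process

variable {N : ℕ}

/-! ## 4. Where S3 lives: the energy shell `(θ'−θ)H ≤ log(1/|δ|)` -/

/-- **S3_shell `KernelTemperatureLipschitzOnShell`** (EQUIV to S3, proved below): S3 asserted
ONLY at phase points on the energy shell `(θ' − θ) H(z) ≤ log |δ|⁻¹`.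
(after CuneoEckmannHairerReyBellet2018, §3 eq. (3.4)) [route leaf · named hypothesis of this cell, NOT filed as a literature fact] -/
def KernelTemperatureLipschitzOnShell : Prop :=
  ∀ ω₂ lam β γ : ℝ, 0 < ω₂ → 0 < lam → 0 < β → 0 < γ →
    ∀ T : ℝ, 0 < T → ∀ N : ℕ, 2 ≤ N → ∀ θ θ' : ℝ, 0 < θ → θ < θ' → θ' < 1 / T →
      ∃ δ₀ C : ℝ, 0 < δ₀ ∧ ∀ δ : ℝ, |δ| < δ₀ →
        ∀ (z : PhaseSpace N),
          (θ' - θ) * (pinnedChain ω₂ lam β γ).hamiltonian N z ≤ Real.log |δ|⁻¹ →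
          ∀ (h : PhaseSpace N → ℝ), Measurable h →
          (∀ y, |h y| ≤ Real.exp (θ * (pinnedChain ω₂ lam β γ).hamiltonian N y)) →
          |∫ y, h y ∂((pinnedChain ω₂ lam β γ).transitionKernel N (T + δ / 2) (T - δ / 2) 1 z) -
              ∫ y, h y ∂((pinnedChain ω₂ lam β γ).transitionKernel N T T 1 z)| ≤
            C * |δ| * Real.exp (θ' * (pinnedChain ω₂ lam β γ).hamiltonian N z)

/-- ★ **S3 ⟺ S3_shell**: off the shell, `e^{θH(z)} < |δ| e^{θ'H(z)}` and both kernel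
integrals are `≤ e^{2θγT} e^{θH(z)}` by CEHR (3.4) (`|δ| < min(T, 1/θ' − T)` keeps the
temperatures positive and `θ' < 1/max(T ± δ/2)`); `δ = 0` is trivial.
[cite: CuneoEckmannHairerReyBellet2018, §3 eq. (3.4)] -/
theorem kernelTemperatureLipschitz_iff_onShell :
    KernelTemperatureLipschitz ↔ KernelTemperatureLipschitzOnShell := by
  constructor
  · intro h3 ω₂ lam β γ hω hl hβ hγ T hT N hN θ θ' hθ hθθ' hθ'1
    obtain ⟨δ₀, C, hδ₀, hb⟩ := h3 ω₂ lam β γ hω hl hβ hγ T hT N hN θ θ' hθ hθθ' hθ'1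
    exact ⟨δ₀, C, hδ₀, fun δ hδ z _ g hgm hg => hb δ hδ z g hgm hg⟩
  · intro hS ω₂ lam β γ hω hl hβ hγ T hT N hN θ θ' hθ hθθ' hθ'1
    obtain ⟨δ₀, C, hδ₀, hb⟩ := hS ω₂ lam β γ hω hl hβ hγ T hT N hN θ θ' hθ hθθ' hθ'1
    have hN0 : 0 < N := lt_of_lt_of_le (by norm_num) hN
    have hθ' : 0 < θ' := hθ.trans hθθ'
    have hTθ' : T < 1 / θ' := (lt_one_div hθ' hT).1 hθ'1
    have hθTT : θ < 1 / max T T := by rw [max_self]; exact hθθ'.trans hθ'1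
    set Hm := (pinnedChain ω₂ lam β γ).hamiltonian N with hHm
    set E : ℝ := Real.exp (θ * γ * (T + T) * ((1 : ℝ≥0) : ℝ)) with hE
    have hE0 : 0 < E := Real.exp_pos _
    set δ₁ : ℝ := min δ₀ (min T (1 / θ' - T)) with hδ₁
    have hδ₁0 : 0 < δ₁ := lt_min hδ₀ (lt_min hT (by linarith))
    refine ⟨δ₁, max C (2 * E), hδ₁0, fun δ hδ z g hgm hg => ?_⟩
    have hδ0' : |δ| < δ₀ := hδ.trans_le (min_le_left _ _)
    have hδT : |δ| < T := (hδ.trans_le (min_le_right _ _)).trans_le (min_le_left _ _)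
    have hδθ : |δ| < 1 / θ' - T := (hδ.trans_le (min_le_right _ _)).trans_le (min_le_right _ _)
    obtain ⟨hδa, hδb⟩ := abs_lt.1 hδT
    obtain ⟨hδc, hδd⟩ := abs_lt.1 hδθ
    have hTL : 0 < T + δ / 2 := by linarith
    have hTR : 0 < T - δ / 2 := by linarith
    have hmax0 : 0 < max (T + δ / 2) (T - δ / 2) := lt_max_of_lt_left hTL
    have hθ'max : θ' < 1 / max (T + δ / 2) (T - δ / 2) :=
      (lt_one_div hθ' hmax0).2 (max_lt (by linarith) (by linarith))
    have hsum : T + δ / 2 + (T - δ / 2) = T + T := by ring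
    have hpos : 0 ≤ |δ| * Real.exp (θ' * Hm z) := by positivity
    by_cases hs : (θ' - θ) * Hm z ≤ Real.log |δ|⁻¹
    · -- on the shell: the hypothesis, with the constant enlarged
      calc |∫ y, g y ∂((pinnedChain ω₂ lam β γ).transitionKernel N (T + δ / 2) (T - δ / 2) 1 z) -
              ∫ y, g y ∂((pinnedChain ω₂ lam β γ).transitionKernel N T T 1 z)|
          ≤ C * |δ| * Real.exp (θ' * Hm z) := hb δ hδ0' z hs g hgm hg
        _ = C * (|δ| * Real.exp (θ' * Hm z)) := by ring
        _ ≤ max C (2 * E) * (|δ| * Real.exp (θ' * Hm z)) :=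
            mul_le_mul_of_nonneg_right (le_max_left _ _) hpos
        _ = max C (2 * E) * |δ| * Real.exp (θ' * Hm z) := by ring
    · -- off the shell: automatic from (3.4)
      rw [not_le] at hs
      by_cases hδ0 : δ = 0
      · subst hδ0
        simp only [zero_div, add_zero, sub_zero, sub_self, abs_zero, mul_zero, zero_mul, le_refl]
      · have hδp : 0 < |δ| := abs_pos.2 hδ0
        have hg1 : ∀ y, |g y| ≤ 1 * Real.exp (θ * Hm y) := fun y => by rw [one_mul]; exact hg y
        have hA := (integrable_and_abs_integral_transitionKernel_le hω hl hβ hγ hN0 hTL hTR hθ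
          (hθθ'.trans hθ'max) 1 z zero_le_one hgm hg1).2
        have hB := (integrable_and_abs_integral_transitionKernel_le hω hl hβ hγ hN0 hT hT hθ
          hθTT 1 z zero_le_one hgm hg1).2
        rw [hsum, one_mul] at hA
        rw [one_mul] at hB
        -- `e^{θH} < |δ| e^{θ'H}` off the shell
        have hshell : Real.exp (θ * Hm z) ≤ |δ| * Real.exp (θ' * Hm z) := by
          have h1 : |δ|⁻¹ < Real.exp ((θ' - θ) * Hm z) := by
            have := Real.exp_lt_exp.2 hs
            rwa [Real.exp_log (inv_pos.2 hδp)] at this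
          have h2 : 1 ≤ |δ| * Real.exp ((θ' - θ) * Hm z) := by
            have := mul_lt_mul_of_pos_left h1 hδp
            rw [mul_inv_cancel₀ hδp.ne'] at this
            exact this.le
          have h3 : Real.exp (θ' * Hm z) = Real.exp ((θ' - θ) * Hm z) * Real.exp (θ * Hm z) := by
            rw [← Real.exp_add]; ring_nf
          rw [h3, ← mul_assoc]
          exact le_mul_of_one_le_left (Real.exp_pos _).le h2
        calc |∫ y, g y ∂((pinnedChain ω₂ lam β γ).transitionKernel N (T + δ / 2) (T - δ / 2) 1 z) -
                ∫ y, g y ∂((pinnedChain ω₂ lam β γ).transitionKernel N T T 1 z)|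
            ≤ E * Real.exp (θ * Hm z) + E * Real.exp (θ * Hm z) :=
              (abs_sub _ _).trans (add_le_add hA hB)
          _ = 2 * E * Real.exp (θ * Hm z) := by ring
          _ ≤ 2 * E * (|δ| * Real.exp (θ' * Hm z)) :=
              mul_le_mul_of_nonneg_left hshell (by positivity)
          _ ≤ max C (2 * E) * (|δ| * Real.exp (θ' * Hm z)) :=
              mul_le_mul_of_nonneg_right (le_max_right _ _) hpos
          _ = max C (2 * E) * |δ| * Real.exp (θ' * Hm z) := by ring

/-! ## 5. The junction through the graded leaves -/

/-- **Glue `A0 → A2 → S3♭ → A3p → A4 → (W)`.** [folklore] -/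
theorem energyWindowControl_of_atoms₅L (h0 : NessGibbsReweighting) (h2 : NessOddLogRatioBound)
    (h3 : KernelTemperatureLipschitzPolyLoss) (h3p : NessFloorMeanValue)
    (h4 : NessLinearResponseL2) : EnergyWindowControl :=
  energyWindowControl_of_atoms₅K h0 h2 (kernelTemperatureLipschitz_of_polyLoss h3) h3p h4

/-- ★ **The junction `K_fix ⟸ A0 ∧ A2 ∧ S3♭ ∧ A3p ∧ A4`** (polynomial-loss leaf). [folklore] -/
theorem snapshotKLUpperExpansion_of_atoms₅L (h0 : NessGibbsReweighting)
    (h2 : NessOddLogRatioBound) (h3 : KernelTemperatureLipschitzPolyLoss) (h3p : NessFloorMeanValue)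
    (h4 : NessLinearResponseL2) : SnapshotKLUpperExpansion :=
  snapshotKLUpperExpansion_of_atoms₅K h0 h2 (kernelTemperatureLipschitz_of_polyLoss h3) h3p h4

/-- The junction through the subexponential rung `K_fix ⟸ A0 ∧ A2 ∧ S3♮ ∧ A3p ∧ A4`. [folklore] -/
theorem snapshotKLUpperExpansion_of_atoms₅L' (h0 : NessGibbsReweighting)
    (h2 : NessOddLogRatioBound) (h3 : KernelTemperatureLipschitzSubexpLoss)
    (h3p : NessFloorMeanValue) (h4 : NessLinearResponseL2) : SnapshotKLUpperExpansion :=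
  snapshotKLUpperExpansion_of_atoms₅K h0 h2 (kernelTemperatureLipschitz_of_subexpLoss h3) h3p h4

/-- The junction through the Vega-derivative leaf `K_fix ⟸ A0 ∧ A2 ∧ S3∂ ∧ A3p ∧ A4`. [folklore] -/
theorem snapshotKLUpperExpansion_of_atoms₅L'' (h0 : NessGibbsReweighting)
    (h2 : NessOddLogRatioBound) (h3 : KernelTemperatureDerivPolyBound)
    (h3p : NessFloorMeanValue) (h4 : NessLinearResponseL2) : SnapshotKLUpperExpansion :=
  snapshotKLUpperExpansion_of_atoms₅K h0 h2 (kernelTemperatureLipschitz_of_derivPolyBound h3) h3p h4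

end Summit.AtomisticToContinuum.FouriersLaw.Theorems.ExtensiveSnapshotIrreversibility.EnergyWindow

end
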